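import Summits.BirchSwinnertonDyer.BirchSwinnertonDyer.Theorems.KatoDescentPotSupersingularWildUpperUnitTwistRecordsSharpP06
import Summits.BirchSwinnertonDyer.BirchSwinnertonDyer.Theorems.KatoDescentPotSupersingularWildUpperUnitTwistRecordsSharpP07
import Summits.BirchSwinnertonDyer.BirchSwinnertonDyer.Theorems.KatoDescentPotSupersingularWildUpperUnitTwistRecordsSharpP08
import Summits.BirchSwinnertonDyer.Rank1Residual.Additive.IntModelTamagawaCertificateLocal
import HarnessLib

/-!
# Route `KatoDescentPotSupersingular` (rung K9, sub-rung B5 = O6 wild `p = 3`, cell `bsd-potss`): TAMAGAWA KERNEL UPGRADE of the ♯ₚ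
# unit-twist records — `∏ c_ℓ(E)` and `c₃(E) = 3` IN THE KERNEL by the rank-2 observatory's Tate certificates, so that the displayed
# single-carrier clause `hcarrier` of each ♯ₚ record is DISCHARGED (part 03: 42336db1@3, 43200ji1@3, 73008dk1@3, 73008dm1@3, 84672je1@3)
# (seat `bsd-potss-k9-c4` g17; `--supports stmt-BirchSwinnertonDyer-19197 --as helper`)

HONEST FRAMING. THEOREMS ONLY (no definition, no named fact, no `sorry`); PER PAIR; nothing booked; items 19189 / 19197 / 21422 stay
OPEN class-wide; BSD is not proved for any class.  Each ♯ₚ record `WildUpperUnitTwistRecords.missingUpperBoundAt_g<label>_3` (files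
`…WildUpperUnitTwistRecordsSharpPNN`, this seat, road p610552) displays, among its per-row hypotheses, the single-carrier clause
`hcarrier : ord₃ ∏ c_ℓ(E) ≤ ord₃ c₃(E)` (read off Cremona's table / k8t-c4 g6's PARI census).  The rank-2 observatory's KERNEL
TAMAGAWA CERTIFICATES (`Theorems/Rank2ObservatoryTamagawa{Local,Cert,ExactCert,KernelCert}` — Tate's algorithm as `decide`-able
certificates `TamLocal` / `TamX` / `TamZ` with ONE soundness theorem per stage, NO named fact) and the b2b-bsdres n1011 bridge to a
globally minimal `W / ℚ` with a literal integral model (`Additive/IntModelTamagawaCertificate{,Local}`: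
`tamagawaProduct_eq_rowValueZ_of_intModel`, `localTamagawaNumber_padic_eq_of_intModel_of_tamX`) make both sides of that clause KERNEL
NUMERALS: per row below, `rowCheckZ_g<label>` (the row certificate checks, `decide +kernel`), `tamagawaProduct_g<label> : ∏ c_ℓ(W) = v`,
`localTamagawaNumber_three_g<label> : c(W / ℚ_[3]) = 3` (Kodaira IV* at `3`, Step-8 quadratic with a residue root — stage-2 exact
certificate `TamX` kind 3), `carrier_g<label>` (the clause itself, `v = 3·m`, `3 ∤ m`), and the corollary
`missingUpperBoundAt_g<label>_3_tam` = the record with `hcarrier` REMOVED (every other displayed binder unchanged: named facts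
`hGZ hKo hGZK hmod`, the schema `hJp`, Cremona's `N`, `r_an = 0`, «tower not onto», the lattice-optimal datum with `3 ∤ c(D)`, the
field, the twist numerics).  Certificates emitted by n1011-p03's `tools/tamcert.py` over the observatory's `kernel-tam3/engine1`
(`tam.py` / `tamx.py` / `tamz.py`, unmodified) and RE-CHECKED here by the kernel; the certified products agree with Cremona's `∏ c_ℓ`
and k8t-c4 g6's PARI `elllocalred` table on every row (generator asserts).

References: [Tate1975] §7; [Silverman1994] IV.9.4 Steps 1–10; [SilvermanAEC2009] VII.1 Rem. 1.1, VII.6; [CremonaAlgorithms1997] §3.2,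
Table 1; [Jetchev2008] Cor. 1.5; [Miller2011LMS] Def. 1.1.
-/

set_option autoImplicit false
set_option linter.dupNamespace false
noncomputable section
open scoped Classical NumberField
open WeierstrassCurve NumberField Field
  Literature.NumberTheory.EllipticCurves
  Literature.NumberTheory.EllipticCurves.ModularForms Literature.NumberTheory.EllipticCurves.Rank1Residual
  Literature.NumberTheory.EllipticCurves.Rank1Residual.Typed Literature.NumberTheory.Automorphic
  Summit.BirchSwinnertonDyer.BirchSwinnertonDyer.Rank2Observatory.Tam
  Summit.BirchSwinnertonDyer.Rank1Residual.Additive.IntModelTam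
  Summit.BirchSwinnertonDyer.BirchSwinnertonDyer.Rank1Residual.IntModel
  Summit.BirchSwinnertonDyer.Rank1Residual Summit.BirchSwinnertonDyer.Rank1Residual.Additive
  Summit.BirchSwinnertonDyer.BirchSwinnertonDyer.Theorems

namespace Summit.BirchSwinnertonDyer.BirchSwinnertonDyer.Theorems.WildUpperUnitTwistRecords

/-! ### `42336db1` (`N = 42336 = 2^5·3^3·7^2`, record file `…SharpP06`): Tate certificates — `2`: III*, `c = 2`; `3`: IV*, `c = 3`; `7`: I0*, `c = 1`; `∏ c_ℓ = 6` (Cremona: `6`) -/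

/-- Row certificate of `42336db1 = [0, 0, 0, -10584, 444528]` (stage 1 `TamLocal` at every bad prime + stage 2 `TamX` at the IV*-prime `3`): checks in the
kernel. [cite: Silverman1994, IV.9.4] [cite: Tate1975, §7] [cite: CremonaAlgorithms1997, Table 1 (Cremona label 42336db1)] -/
theorem rowCheckZ_g42336db1 :
    TamZ.rowCheckZ [⟨2, 1, 5, 0, 0, 0, 4, 12, 9, 0, 2⟩, ⟨3, 1, 5, 0, 0, 0, 0, 9, 8, 0, 3⟩, ⟨7, 2, 5, 0, 0, 0, 0, 6, 6, 0, 1⟩] [⟨3, 1, 3, 0, 0, 0, 9, 1⟩] [⟨7, 9, 0, 0, 0, 6, 0, 0⟩]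
      (⟨0, 0, 0, -10584, 444528⟩ : WeierstrassCurve ℤ) = true := by
  decide +kernel

/-- **`∏_ℓ c_ℓ (42336db1) = 6` IN THE KERNEL** for any globally minimal `W / ℚ` with this integral model. [cite: Silverman1994, IV.9.4]
[cite: CremonaAlgorithms1997, Table 1 (Cremona label 42336db1)] -/
theorem tamagawaProduct_g42336db1 {W : WeierstrassCurve ℚ} [W.IsGloballyMinimal]
    (hI : integralModelInt W = (⟨0, 0, 0, -10584, 444528⟩ : WeierstrassCurve ℤ)) : W.tamagawaProduct = 6 :=
  (tamagawaProduct_eq_rowValueZ_of_intModel hI rowCheckZ_g42336db1 (by decide +kernel)).trans (by decide +kernel)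

/-- **`c(W / ℚ_[3]) (42336db1) = 3` IN THE KERNEL** (Kodaira type IV* at `3`, residue root witness `1` of the exit quadratic after
`(r, s, t) = (0, 0, 0)`: exact certificate `TamX` kind 3). [cite: Silverman1994, IV.9.4 Step 8] [cite: CremonaAlgorithms1997, Table 1 (Cremona label 42336db1)] -/
theorem localTamagawaNumber_three_g42336db1 {W : WeierstrassCurve ℚ} [W.IsElliptic] [W.IsGloballyMinimal]
    (hI : integralModelInt W = (⟨0, 0, 0, -10584, 444528⟩ : WeierstrassCurve ℤ)) :
    (W.baseChange ℚ_[3]).localTamagawaNumber ℤ_[3] = 3 :=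
  localTamagawaNumber_padic_eq_of_intModel_of_tamX hI 3 (F := ⟨3, 1, 3, 0, 0, 0, 9, 1⟩) rfl (by decide +kernel)

/-- **The single-carrier clause of the ♯ₚ record for `42336db1` IN THE KERNEL**: `ord₃ ∏ c_ℓ ≤ ord₃ c₃` (`6 = 3·2`, `3 ∤ 2`).
[cite: Silverman1994, IV.9.4] [cite: CremonaAlgorithms1997, Table 1 (Cremona label 42336db1)] -/
theorem carrier_g42336db1 {W : WeierstrassCurve ℚ} [W.IsElliptic] [W.IsGloballyMinimal]
    (hI : integralModelInt W = (⟨0, 0, 0, -10584, 444528⟩ : WeierstrassCurve ℤ)) :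
    padicValNat 3 W.tamagawaProduct ≤ padicValNat 3 ((W.baseChange ℚ_[3]).localTamagawaNumber ℤ_[3]) := by
  rw [tamagawaProduct_g42336db1 hI, localTamagawaNumber_three_g42336db1 hI]
  exact le_of_eq (padicValNat_eq_padicValNat_of_eq_mul (m := 2) Nat.prime_three rfl (by norm_num) (by norm_num))

/-- **RECORD `42336db1` @ `3` with the Tamagawa clause DISCHARGED** — `WildUpperUnitTwistRecords.missingUpperBoundAt_g42336db1_3` (file
`…SharpP06`, ♯ₚ road p610552) with `hcarrier` supplied by `carrier_g42336db1`; every other displayed binder unchanged (named facts,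
schema `hJp`, Cremona's `N = 42336`, `r_an = 0`, «tower not onto», lattice-optimal datum with `3 ∤ c(D)`, `K = ℚ(√-47)`, twist numerics).
Per pair; nothing booked; BSD is not proved by this. [cite: Jetchev2008, Cor. 1.5 (p. 812)] [cite: Silverman1994, IV.9.4]
[cite: Miller2011LMS, Def. 1.1] [cite: CremonaAlgorithms1997, Table 1 (Cremona label 42336db1)] -/
theorem missingUpperBoundAt_g42336db1_3_tam
    (hGZ : ∀ (N : ℕ) [NeZero N] (W : WeierstrassCurve ℚ) (K : Type) [Field K] [NumberField K],
      gross_zagier N W K)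
    (hKo : ∀ (N : ℕ) [NeZero N] (W : WeierstrassCurve ℚ) (K : Type) [Field K] [NumberField K],
      kolyvagin N W K)
    (hGZK : rank_eq_analyticRank_of_analyticRank_le_one) (hmod : hasEntireLFunction_rat)
    (hJp : ∀ (N : ℕ) [NeZero N] (W : WeierstrassCurve ℚ) [W.IsElliptic] [W.IsGloballyMinimal]
      (K : Type) [Field K] [NumberField K],
      IsImaginaryQuadratic K → NumberField.discr K ≠ -3 →
      SatisfiesHeegnerHypothesis N K → SatisfiesHeegnerHypothesis 2 K →
      ∀ (p : ℕ) [Fact p.Prime], p ≠ 2 → W.analyticRank = 0 → Addv W p → 0 ≤ padicValRat p W.j →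
      ¬ W.HasCM → W.HasIrreducibleModPGaloisRep p →
      ¬ (∀ n : ℕ, W.HasSurjectiveModNGaloisRep (p ^ n : ℕ)) →
      (∃ Dt : ModularParametrizationData W N,
        (∀ z ∈ Dt.L.lattice, ∃ w ∈ periodLattice Dt.f, z = (Dt.c : ℂ) * w) ∧ ¬ (p : ℤ) ∣ Dt.c) →
      ∀ {P : (W.baseChange K).toAffine.Point}, IsHeegnerPoint N W K P → ¬ IsOfFinAddOrder P → p ∣ N →
      padicValNat p (Nat.card (AddCommGroup.primaryComponent (W.baseChange K).sha p)) +
          2 * padicValNat p ((W.baseChange ℚ_[p]).localTamagawaNumber ℤ_[p]) ≤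
        2 * padicValNat p (AddSubgroup.zmultiples P).index)
    {W : WeierstrassCurve ℚ} [W.IsElliptic] [W.IsGloballyMinimal] (hWeq : W = (⟨0, 0, 0, (-10584), 444528⟩ : WeierstrassCurve ℚ))
    (hN : W.conductorNorm ℤ = 42336) (hr : W.analyticRank = 0)
    (hns : ¬ (∀ n : ℕ, W.HasSurjectiveModNGaloisRep (3 ^ n : ℕ)))
    (D : ModularParametrizationData W 42336) (hopt : ∀ z ∈ D.L.lattice, ∃ w ∈ periodLattice D.f, z = (D.c : ℂ) * w)
    (hc : ¬ (3 : ℤ) ∣ D.c)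
    (K : Type) [Field K] [NumberField K] (hK : IsImaginaryQuadratic K) (hdK : NumberField.discr K = -47)
    {Wd : WeierstrassCurve ℚ} [Wd.IsElliptic] [Wd.IsGloballyMinimal] (hWdeq : Wd = (⟨0, 0, 0, (-23380056), (-46152230544)⟩ : WeierstrassCurve ℚ))
    (hrd : Wd.analyticRank = 1) {qd : ℚ} (hqd : shaAn Wd = (qd : ℂ)) (hvd : padicValRat 3 qd ≤ 0) :
    MissingUpperBoundAt W 3 := by
  have hI : integralModelInt W = (⟨0, 0, 0, -10584, 444528⟩ : WeierstrassCurve ℤ) := by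
    subst hWeq; exact integralModelInt_eq_of_map_eq _ (map_mk_int 0 0 0 (-10584) 444528)
  exact missingUpperBoundAt_g42336db1_3 hGZ hKo hGZK hmod hJp hWeq hN hr hns D hopt hc (carrier_g42336db1 hI) K hK hdK hWdeq hrd hqd hvd

/-! ### `43200ji1` (`N = 43200 = 2^6·3^3·5^2`, record file `…SharpP06`): Tate certificates — `2`: In*, `c = 4`; `3`: IV*, `c = 3`; `5`: III*, `c = 2`; `∏ c_ℓ = 24` (Cremona: `24`) -/

/-- Row certificate of `43200ji1 = [0, 0, 0, -175500, -28350000]` (stage 1 `TamLocal` at every bad prime + stage 2 `TamX` at the IV*-prime `3`): checks in the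
kernel. [cite: Silverman1994, IV.9.4] [cite: Tate1975, §7] [cite: CremonaAlgorithms1997, Table 1 (Cremona label 43200ji1)] -/
theorem rowCheckZ_g43200ji1 :
    TamZ.rowCheckZ [⟨2, 1, 5, 0, 10, 0, 8, 15, 71, 2, 4⟩, ⟨3, 1, 5, 0, 0, 0, 0, 9, 8, 0, 3⟩, ⟨5, 2, 5, 0, 0, 0, 0, 9, 9, 0, 2⟩] [⟨3, 1, 3, 0, 0, 0, 9, 1⟩] [⟨2, 5, 10, 0, 8, 15, 2, 0⟩]
      (⟨0, 0, 0, -175500, -28350000⟩ : WeierstrassCurve ℤ) = true := by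
  decide +kernel

/-- **`∏_ℓ c_ℓ (43200ji1) = 24` IN THE KERNEL** for any globally minimal `W / ℚ` with this integral model. [cite: Silverman1994, IV.9.4]
[cite: CremonaAlgorithms1997, Table 1 (Cremona label 43200ji1)] -/
theorem tamagawaProduct_g43200ji1 {W : WeierstrassCurve ℚ} [W.IsGloballyMinimal]
    (hI : integralModelInt W = (⟨0, 0, 0, -175500, -28350000⟩ : WeierstrassCurve ℤ)) : W.tamagawaProduct = 24 :=
  (tamagawaProduct_eq_rowValueZ_of_intModel hI rowCheckZ_g43200ji1 (by decide +kernel)).trans (by decide +kernel)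

/-- **`c(W / ℚ_[3]) (43200ji1) = 3` IN THE KERNEL** (Kodaira type IV* at `3`, residue root witness `1` of the exit quadratic after
`(r, s, t) = (0, 0, 0)`: exact certificate `TamX` kind 3). [cite: Silverman1994, IV.9.4 Step 8] [cite: CremonaAlgorithms1997, Table 1 (Cremona label 43200ji1)] -/
theorem localTamagawaNumber_three_g43200ji1 {W : WeierstrassCurve ℚ} [W.IsElliptic] [W.IsGloballyMinimal]
    (hI : integralModelInt W = (⟨0, 0, 0, -175500, -28350000⟩ : WeierstrassCurve ℤ)) :
    (W.baseChange ℚ_[3]).localTamagawaNumber ℤ_[3] = 3 :=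
  localTamagawaNumber_padic_eq_of_intModel_of_tamX hI 3 (F := ⟨3, 1, 3, 0, 0, 0, 9, 1⟩) rfl (by decide +kernel)

/-- **The single-carrier clause of the ♯ₚ record for `43200ji1` IN THE KERNEL**: `ord₃ ∏ c_ℓ ≤ ord₃ c₃` (`24 = 3·8`, `3 ∤ 8`).
[cite: Silverman1994, IV.9.4] [cite: CremonaAlgorithms1997, Table 1 (Cremona label 43200ji1)] -/
theorem carrier_g43200ji1 {W : WeierstrassCurve ℚ} [W.IsElliptic] [W.IsGloballyMinimal]
    (hI : integralModelInt W = (⟨0, 0, 0, -175500, -28350000⟩ : WeierstrassCurve ℤ)) :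
    padicValNat 3 W.tamagawaProduct ≤ padicValNat 3 ((W.baseChange ℚ_[3]).localTamagawaNumber ℤ_[3]) := by
  rw [tamagawaProduct_g43200ji1 hI, localTamagawaNumber_three_g43200ji1 hI]
  exact le_of_eq (padicValNat_eq_padicValNat_of_eq_mul (m := 8) Nat.prime_three rfl (by norm_num) (by norm_num))

/-- **RECORD `43200ji1` @ `3` with the Tamagawa clause DISCHARGED** — `WildUpperUnitTwistRecords.missingUpperBoundAt_g43200ji1_3` (file
`…SharpP06`, ♯ₚ road p610552) with `hcarrier` supplied by `carrier_g43200ji1`; every other displayed binder unchanged (named facts,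
schema `hJp`, Cremona's `N = 43200`, `r_an = 0`, «tower not onto», lattice-optimal datum with `3 ∤ c(D)`, `K = ℚ(√-71)`, twist numerics).
Per pair; nothing booked; BSD is not proved by this. [cite: Jetchev2008, Cor. 1.5 (p. 812)] [cite: Silverman1994, IV.9.4]
[cite: Miller2011LMS, Def. 1.1] [cite: CremonaAlgorithms1997, Table 1 (Cremona label 43200ji1)] -/
theorem missingUpperBoundAt_g43200ji1_3_tam
    (hGZ : ∀ (N : ℕ) [NeZero N] (W : WeierstrassCurve ℚ) (K : Type) [Field K] [NumberField K],
      gross_zagier N W K)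
    (hKo : ∀ (N : ℕ) [NeZero N] (W : WeierstrassCurve ℚ) (K : Type) [Field K] [NumberField K],
      kolyvagin N W K)
    (hGZK : rank_eq_analyticRank_of_analyticRank_le_one) (hmod : hasEntireLFunction_rat)
    (hJp : ∀ (N : ℕ) [NeZero N] (W : WeierstrassCurve ℚ) [W.IsElliptic] [W.IsGloballyMinimal]
      (K : Type) [Field K] [NumberField K],
      IsImaginaryQuadratic K → NumberField.discr K ≠ -3 →
      SatisfiesHeegnerHypothesis N K → SatisfiesHeegnerHypothesis 2 K →
      ∀ (p : ℕ) [Fact p.Prime], p ≠ 2 → W.analyticRank = 0 → Addv W p → 0 ≤ padicValRat p W.j →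
      ¬ W.HasCM → W.HasIrreducibleModPGaloisRep p →
      ¬ (∀ n : ℕ, W.HasSurjectiveModNGaloisRep (p ^ n : ℕ)) →
      (∃ Dt : ModularParametrizationData W N,
        (∀ z ∈ Dt.L.lattice, ∃ w ∈ periodLattice Dt.f, z = (Dt.c : ℂ) * w) ∧ ¬ (p : ℤ) ∣ Dt.c) →
      ∀ {P : (W.baseChange K).toAffine.Point}, IsHeegnerPoint N W K P → ¬ IsOfFinAddOrder P → p ∣ N →
      padicValNat p (Nat.card (AddCommGroup.primaryComponent (W.baseChange K).sha p)) +
          2 * padicValNat p ((W.baseChange ℚ_[p]).localTamagawaNumber ℤ_[p]) ≤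
        2 * padicValNat p (AddSubgroup.zmultiples P).index)
    {W : WeierstrassCurve ℚ} [W.IsElliptic] [W.IsGloballyMinimal] (hWeq : W = (⟨0, 0, 0, (-175500), (-28350000)⟩ : WeierstrassCurve ℚ))
    (hN : W.conductorNorm ℤ = 43200) (hr : W.analyticRank = 0)
    (hns : ¬ (∀ n : ℕ, W.HasSurjectiveModNGaloisRep (3 ^ n : ℕ)))
    (D : ModularParametrizationData W 43200) (hopt : ∀ z ∈ D.L.lattice, ∃ w ∈ periodLattice D.f, z = (D.c : ℂ) * w)
    (hc : ¬ (3 : ℤ) ∣ D.c)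
    (K : Type) [Field K] [NumberField K] (hK : IsImaginaryQuadratic K) (hdK : NumberField.discr K = -71)
    {Wd : WeierstrassCurve ℚ} [Wd.IsElliptic] [Wd.IsGloballyMinimal] (hWdeq : Wd = (⟨0, 0, 0, (-884695500), 10146776850000⟩ : WeierstrassCurve ℚ))
    (hrd : Wd.analyticRank = 1) {qd : ℚ} (hqd : shaAn Wd = (qd : ℂ)) (hvd : padicValRat 3 qd ≤ 0) :
    MissingUpperBoundAt W 3 := by
  have hI : integralModelInt W = (⟨0, 0, 0, -175500, -28350000⟩ : WeierstrassCurve ℤ) := by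
    subst hWeq; exact integralModelInt_eq_of_map_eq _ (map_mk_int 0 0 0 (-175500) (-28350000))
  exact missingUpperBoundAt_g43200ji1_3 hGZ hKo hGZK hmod hJp hWeq hN hr hns D hopt hc (carrier_g43200ji1 hI) K hK hdK hWdeq hrd hqd hvd

/-! ### `73008dk1` (`N = 73008 = 2^4·3^3·13^2`, record file `…SharpP07`): Tate certificates — `2`: In*, `c = 2`; `3`: IV*, `c = 3`; `13`: III*, `c = 2`; `∏ c_ℓ = 12` (Cremona: `12`) -/

/-- Row certificate of `73008dk1 = [0, 0, 0, -296595, 140348754]` (stage 1 `TamLocal` at every bad prime + stage 2 `TamX` at the IV*-prime `3`): checks in the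
kernel. [cite: Silverman1994, IV.9.4] [cite: Tate1975, §7] [cite: CremonaAlgorithms1997, Table 1 (Cremona label 73008dk1)] -/
theorem rowCheckZ_g73008dk1 :
    TamZ.rowCheckZ [⟨2, 1, 5, 0, 9, 1, 16, 15, 71, 3, 2⟩, ⟨3, 1, 5, 0, 3, 0, 0, 9, 8, 0, 3⟩, ⟨13, 3, 5, 0, 0, 0, 0, 9, 9, 0, 2⟩] [⟨3, 1, 3, 3, 0, 0, 9, 1⟩] [⟨2, 6, 9, 1, 16, 15, 3, 0⟩]
      (⟨0, 0, 0, -296595, 140348754⟩ : WeierstrassCurve ℤ) = true := by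
  decide +kernel

/-- **`∏_ℓ c_ℓ (73008dk1) = 12` IN THE KERNEL** for any globally minimal `W / ℚ` with this integral model. [cite: Silverman1994, IV.9.4]
[cite: CremonaAlgorithms1997, Table 1 (Cremona label 73008dk1)] -/
theorem tamagawaProduct_g73008dk1 {W : WeierstrassCurve ℚ} [W.IsGloballyMinimal]
    (hI : integralModelInt W = (⟨0, 0, 0, -296595, 140348754⟩ : WeierstrassCurve ℤ)) : W.tamagawaProduct = 12 :=
  (tamagawaProduct_eq_rowValueZ_of_intModel hI rowCheckZ_g73008dk1 (by decide +kernel)).trans (by decide +kernel)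

/-- **`c(W / ℚ_[3]) (73008dk1) = 3` IN THE KERNEL** (Kodaira type IV* at `3`, residue root witness `1` of the exit quadratic after
`(r, s, t) = (3, 0, 0)`: exact certificate `TamX` kind 3). [cite: Silverman1994, IV.9.4 Step 8] [cite: CremonaAlgorithms1997, Table 1 (Cremona label 73008dk1)] -/
theorem localTamagawaNumber_three_g73008dk1 {W : WeierstrassCurve ℚ} [W.IsElliptic] [W.IsGloballyMinimal]
    (hI : integralModelInt W = (⟨0, 0, 0, -296595, 140348754⟩ : WeierstrassCurve ℤ)) :
    (W.baseChange ℚ_[3]).localTamagawaNumber ℤ_[3] = 3 :=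
  localTamagawaNumber_padic_eq_of_intModel_of_tamX hI 3 (F := ⟨3, 1, 3, 3, 0, 0, 9, 1⟩) rfl (by decide +kernel)

/-- **The single-carrier clause of the ♯ₚ record for `73008dk1` IN THE KERNEL**: `ord₃ ∏ c_ℓ ≤ ord₃ c₃` (`12 = 3·4`, `3 ∤ 4`).
[cite: Silverman1994, IV.9.4] [cite: CremonaAlgorithms1997, Table 1 (Cremona label 73008dk1)] -/
theorem carrier_g73008dk1 {W : WeierstrassCurve ℚ} [W.IsElliptic] [W.IsGloballyMinimal]
    (hI : integralModelInt W = (⟨0, 0, 0, -296595, 140348754⟩ : WeierstrassCurve ℤ)) :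
    padicValNat 3 W.tamagawaProduct ≤ padicValNat 3 ((W.baseChange ℚ_[3]).localTamagawaNumber ℤ_[3]) := by
  rw [tamagawaProduct_g73008dk1 hI, localTamagawaNumber_three_g73008dk1 hI]
  exact le_of_eq (padicValNat_eq_padicValNat_of_eq_mul (m := 4) Nat.prime_three rfl (by norm_num) (by norm_num))

/-- **RECORD `73008dk1` @ `3` with the Tamagawa clause DISCHARGED** — `WildUpperUnitTwistRecords.missingUpperBoundAt_g73008dk1_3` (file
`…SharpP07`, ♯ₚ road p610552) with `hcarrier` supplied by `carrier_g73008dk1`; every other displayed binder unchanged (named facts,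
schema `hJp`, Cremona's `N = 73008`, `r_an = 0`, «tower not onto», lattice-optimal datum with `3 ∤ c(D)`, `K = ℚ(√-23)`, twist numerics).
Per pair; nothing booked; BSD is not proved by this. [cite: Jetchev2008, Cor. 1.5 (p. 812)] [cite: Silverman1994, IV.9.4]
[cite: Miller2011LMS, Def. 1.1] [cite: CremonaAlgorithms1997, Table 1 (Cremona label 73008dk1)] -/
theorem missingUpperBoundAt_g73008dk1_3_tam
    (hGZ : ∀ (N : ℕ) [NeZero N] (W : WeierstrassCurve ℚ) (K : Type) [Field K] [NumberField K],
      gross_zagier N W K)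
    (hKo : ∀ (N : ℕ) [NeZero N] (W : WeierstrassCurve ℚ) (K : Type) [Field K] [NumberField K],
      kolyvagin N W K)
    (hGZK : rank_eq_analyticRank_of_analyticRank_le_one) (hmod : hasEntireLFunction_rat)
    (hJp : ∀ (N : ℕ) [NeZero N] (W : WeierstrassCurve ℚ) [W.IsElliptic] [W.IsGloballyMinimal]
      (K : Type) [Field K] [NumberField K],
      IsImaginaryQuadratic K → NumberField.discr K ≠ -3 →
      SatisfiesHeegnerHypothesis N K → SatisfiesHeegnerHypothesis 2 K →
      ∀ (p : ℕ) [Fact p.Prime], p ≠ 2 → W.analyticRank = 0 → Addv W p → 0 ≤ padicValRat p W.j →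
      ¬ W.HasCM → W.HasIrreducibleModPGaloisRep p →
      ¬ (∀ n : ℕ, W.HasSurjectiveModNGaloisRep (p ^ n : ℕ)) →
      (∃ Dt : ModularParametrizationData W N,
        (∀ z ∈ Dt.L.lattice, ∃ w ∈ periodLattice Dt.f, z = (Dt.c : ℂ) * w) ∧ ¬ (p : ℤ) ∣ Dt.c) →
      ∀ {P : (W.baseChange K).toAffine.Point}, IsHeegnerPoint N W K P → ¬ IsOfFinAddOrder P → p ∣ N →
      padicValNat p (Nat.card (AddCommGroup.primaryComponent (W.baseChange K).sha p)) +
          2 * padicValNat p ((W.baseChange ℚ_[p]).localTamagawaNumber ℤ_[p]) ≤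
        2 * padicValNat p (AddSubgroup.zmultiples P).index)
    {W : WeierstrassCurve ℚ} [W.IsElliptic] [W.IsGloballyMinimal] (hWeq : W = (⟨0, 0, 0, (-296595), 140348754⟩ : WeierstrassCurve ℚ))
    (hN : W.conductorNorm ℤ = 73008) (hr : W.analyticRank = 0)
    (hns : ¬ (∀ n : ℕ, W.HasSurjectiveModNGaloisRep (3 ^ n : ℕ)))
    (D : ModularParametrizationData W 73008) (hopt : ∀ z ∈ D.L.lattice, ∃ w ∈ periodLattice D.f, z = (D.c : ℂ) * w)
    (hc : ¬ (3 : ℤ) ∣ D.c)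
    (K : Type) [Field K] [NumberField K] (hK : IsImaginaryQuadratic K) (hdK : NumberField.discr K = -23)
    {Wd : WeierstrassCurve ℚ} [Wd.IsElliptic] [Wd.IsGloballyMinimal] (hWdeq : Wd = (⟨0, 0, 0, (-156898755), (-1707623289918)⟩ : WeierstrassCurve ℚ))
    (hrd : Wd.analyticRank = 1) {qd : ℚ} (hqd : shaAn Wd = (qd : ℂ)) (hvd : padicValRat 3 qd ≤ 0) :
    MissingUpperBoundAt W 3 := by
  have hI : integralModelInt W = (⟨0, 0, 0, -296595, 140348754⟩ : WeierstrassCurve ℤ) := by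
    subst hWeq; exact integralModelInt_eq_of_map_eq _ (map_mk_int 0 0 0 (-296595) 140348754)
  exact missingUpperBoundAt_g73008dk1_3 hGZ hKo hGZK hmod hJp hWeq hN hr hns D hopt hc (carrier_g73008dk1 hI) K hK hdK hWdeq hrd hqd hvd

/-! ### `73008dm1` (`N = 73008 = 2^4·3^3·13^2`, record file `…SharpP07`): Tate certificates — `2`: In*, `c = 2`; `3`: IV*, `c = 3`; `13`: III*, `c = 2`; `∏ c_ℓ = 12` (Cremona: `12`) -/

/-- Row certificate of `73008dm1 = [0, 0, 0, -2669355, 1343338074]` (stage 1 `TamLocal` at every bad prime + stage 2 `TamX` at the IV*-prime `3`): checks in the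
kernel. [cite: Silverman1994, IV.9.4] [cite: Tate1975, §7] [cite: CremonaAlgorithms1997, Table 1 (Cremona label 73008dm1)] -/
theorem rowCheckZ_g73008dm1 :
    TamZ.rowCheckZ [⟨2, 1, 5, 0, 149, 1, 384, 21, 71, 6, 2⟩, ⟨3, 1, 5, 0, 3, 0, 0, 9, 8, 0, 3⟩, ⟨13, 3, 5, 0, 0, 0, 0, 9, 9, 0, 2⟩] [⟨3, 1, 3, 3, 0, 0, 9, 1⟩] [⟨2, 6, 149, 1, 384, 21, 6, 0⟩]
      (⟨0, 0, 0, -2669355, 1343338074⟩ : WeierstrassCurve ℤ) = true := by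
  decide +kernel

/-- **`∏_ℓ c_ℓ (73008dm1) = 12` IN THE KERNEL** for any globally minimal `W / ℚ` with this integral model. [cite: Silverman1994, IV.9.4]
[cite: CremonaAlgorithms1997, Table 1 (Cremona label 73008dm1)] -/
theorem tamagawaProduct_g73008dm1 {W : WeierstrassCurve ℚ} [W.IsGloballyMinimal]
    (hI : integralModelInt W = (⟨0, 0, 0, -2669355, 1343338074⟩ : WeierstrassCurve ℤ)) : W.tamagawaProduct = 12 :=
  (tamagawaProduct_eq_rowValueZ_of_intModel hI rowCheckZ_g73008dm1 (by decide +kernel)).trans (by decide +kernel)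

/-- **`c(W / ℚ_[3]) (73008dm1) = 3` IN THE KERNEL** (Kodaira type IV* at `3`, residue root witness `1` of the exit quadratic after
`(r, s, t) = (3, 0, 0)`: exact certificate `TamX` kind 3). [cite: Silverman1994, IV.9.4 Step 8] [cite: CremonaAlgorithms1997, Table 1 (Cremona label 73008dm1)] -/
theorem localTamagawaNumber_three_g73008dm1 {W : WeierstrassCurve ℚ} [W.IsElliptic] [W.IsGloballyMinimal]
    (hI : integralModelInt W = (⟨0, 0, 0, -2669355, 1343338074⟩ : WeierstrassCurve ℤ)) :
    (W.baseChange ℚ_[3]).localTamagawaNumber ℤ_[3] = 3 :=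
  localTamagawaNumber_padic_eq_of_intModel_of_tamX hI 3 (F := ⟨3, 1, 3, 3, 0, 0, 9, 1⟩) rfl (by decide +kernel)

/-- **The single-carrier clause of the ♯ₚ record for `73008dm1` IN THE KERNEL**: `ord₃ ∏ c_ℓ ≤ ord₃ c₃` (`12 = 3·4`, `3 ∤ 4`).
[cite: Silverman1994, IV.9.4] [cite: CremonaAlgorithms1997, Table 1 (Cremona label 73008dm1)] -/
theorem carrier_g73008dm1 {W : WeierstrassCurve ℚ} [W.IsElliptic] [W.IsGloballyMinimal]
    (hI : integralModelInt W = (⟨0, 0, 0, -2669355, 1343338074⟩ : WeierstrassCurve ℤ)) :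
    padicValNat 3 W.tamagawaProduct ≤ padicValNat 3 ((W.baseChange ℚ_[3]).localTamagawaNumber ℤ_[3]) := by
  rw [tamagawaProduct_g73008dm1 hI, localTamagawaNumber_three_g73008dm1 hI]
  exact le_of_eq (padicValNat_eq_padicValNat_of_eq_mul (m := 4) Nat.prime_three rfl (by norm_num) (by norm_num))

/-- **RECORD `73008dm1` @ `3` with the Tamagawa clause DISCHARGED** — `WildUpperUnitTwistRecords.missingUpperBoundAt_g73008dm1_3` (file
`…SharpP07`, ♯ₚ road p610552) with `hcarrier` supplied by `carrier_g73008dm1`; every other displayed binder unchanged (named facts,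
schema `hJp`, Cremona's `N = 73008`, `r_an = 0`, «tower not onto», lattice-optimal datum with `3 ∤ c(D)`, `K = ℚ(√-23)`, twist numerics).
Per pair; nothing booked; BSD is not proved by this. [cite: Jetchev2008, Cor. 1.5 (p. 812)] [cite: Silverman1994, IV.9.4]
[cite: Miller2011LMS, Def. 1.1] [cite: CremonaAlgorithms1997, Table 1 (Cremona label 73008dm1)] -/
theorem missingUpperBoundAt_g73008dm1_3_tam
    (hGZ : ∀ (N : ℕ) [NeZero N] (W : WeierstrassCurve ℚ) (K : Type) [Field K] [NumberField K],
      gross_zagier N W K)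
    (hKo : ∀ (N : ℕ) [NeZero N] (W : WeierstrassCurve ℚ) (K : Type) [Field K] [NumberField K],
      kolyvagin N W K)
    (hGZK : rank_eq_analyticRank_of_analyticRank_le_one) (hmod : hasEntireLFunction_rat)
    (hJp : ∀ (N : ℕ) [NeZero N] (W : WeierstrassCurve ℚ) [W.IsElliptic] [W.IsGloballyMinimal]
      (K : Type) [Field K] [NumberField K],
      IsImaginaryQuadratic K → NumberField.discr K ≠ -3 →
      SatisfiesHeegnerHypothesis N K → SatisfiesHeegnerHypothesis 2 K →
      ∀ (p : ℕ) [Fact p.Prime], p ≠ 2 → W.analyticRank = 0 → Addv W p → 0 ≤ padicValRat p W.j →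
      ¬ W.HasCM → W.HasIrreducibleModPGaloisRep p →
      ¬ (∀ n : ℕ, W.HasSurjectiveModNGaloisRep (p ^ n : ℕ)) →
      (∃ Dt : ModularParametrizationData W N,
        (∀ z ∈ Dt.L.lattice, ∃ w ∈ periodLattice Dt.f, z = (Dt.c : ℂ) * w) ∧ ¬ (p : ℤ) ∣ Dt.c) →
      ∀ {P : (W.baseChange K).toAffine.Point}, IsHeegnerPoint N W K P → ¬ IsOfFinAddOrder P → p ∣ N →
      padicValNat p (Nat.card (AddCommGroup.primaryComponent (W.baseChange K).sha p)) +
          2 * padicValNat p ((W.baseChange ℚ_[p]).localTamagawaNumber ℤ_[p]) ≤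
        2 * padicValNat p (AddSubgroup.zmultiples P).index)
    {W : WeierstrassCurve ℚ} [W.IsElliptic] [W.IsGloballyMinimal] (hWeq : W = (⟨0, 0, 0, (-2669355), 1343338074⟩ : WeierstrassCurve ℚ))
    (hN : W.conductorNorm ℤ = 73008) (hr : W.analyticRank = 0)
    (hns : ¬ (∀ n : ℕ, W.HasSurjectiveModNGaloisRep (3 ^ n : ℕ)))
    (D : ModularParametrizationData W 73008) (hopt : ∀ z ∈ D.L.lattice, ∃ w ∈ periodLattice D.f, z = (D.c : ℂ) * w)
    (hc : ¬ (3 : ℤ) ∣ D.c)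
    (K : Type) [Field K] [NumberField K] (hK : IsImaginaryQuadratic K) (hdK : NumberField.discr K = -23)
    {Wd : WeierstrassCurve ℚ} [Wd.IsElliptic] [Wd.IsGloballyMinimal] (hWdeq : Wd = (⟨0, 0, 0, (-1412088795), (-16344394346358)⟩ : WeierstrassCurve ℚ))
    (hrd : Wd.analyticRank = 1) {qd : ℚ} (hqd : shaAn Wd = (qd : ℂ)) (hvd : padicValRat 3 qd ≤ 0) :
    MissingUpperBoundAt W 3 := by
  have hI : integralModelInt W = (⟨0, 0, 0, -2669355, 1343338074⟩ : WeierstrassCurve ℤ) := by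
    subst hWeq; exact integralModelInt_eq_of_map_eq _ (map_mk_int 0 0 0 (-2669355) 1343338074)
  exact missingUpperBoundAt_g73008dm1_3 hGZ hKo hGZK hmod hJp hWeq hN hr hns D hopt hc (carrier_g73008dm1 hI) K hK hdK hWdeq hrd hqd hvd

/-! ### `84672je1` (`N = 84672 = 2^6·3^3·7^2`, record file `…SharpP08`): Tate certificates — `2`: II, `c = 1`; `3`: IV*, `c = 3`; `7`: III*, `c = 2`; `∏ c_ℓ = 6` (Cremona: `6`) -/

/-- Row certificate of `84672je1 = [0, 0, 0, -203742, -35395542]` (stage 1 `TamLocal` at every bad prime + stage 2 `TamX` at the IV*-prime `3`): checks in the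
kernel. [cite: Silverman1994, IV.9.4] [cite: Tate1975, §7] [cite: CremonaAlgorithms1997, Table 1 (Cremona label 84672je1)] -/
theorem rowCheckZ_g84672je1 :
    TamZ.rowCheckZ [⟨2, 1, 4, 0, 0, 0, 0, 6, 2, 1, 1⟩, ⟨3, 1, 5, 0, 0, 0, 0, 9, 8, 0, 3⟩, ⟨7, 2, 5, 0, 0, 0, 0, 9, 9, 0, 2⟩] [⟨3, 1, 3, 0, 0, 0, 9, 1⟩] []
      (⟨0, 0, 0, -203742, -35395542⟩ : WeierstrassCurve ℤ) = true := by
  decide +kernel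

/-- **`∏_ℓ c_ℓ (84672je1) = 6` IN THE KERNEL** for any globally minimal `W / ℚ` with this integral model. [cite: Silverman1994, IV.9.4]
[cite: CremonaAlgorithms1997, Table 1 (Cremona label 84672je1)] -/
theorem tamagawaProduct_g84672je1 {W : WeierstrassCurve ℚ} [W.IsGloballyMinimal]
    (hI : integralModelInt W = (⟨0, 0, 0, -203742, -35395542⟩ : WeierstrassCurve ℤ)) : W.tamagawaProduct = 6 :=
  (tamagawaProduct_eq_rowValueZ_of_intModel hI rowCheckZ_g84672je1 (by decide +kernel)).trans (by decide +kernel)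

/-- **`c(W / ℚ_[3]) (84672je1) = 3` IN THE KERNEL** (Kodaira type IV* at `3`, residue root witness `1` of the exit quadratic after
`(r, s, t) = (0, 0, 0)`: exact certificate `TamX` kind 3). [cite: Silverman1994, IV.9.4 Step 8] [cite: CremonaAlgorithms1997, Table 1 (Cremona label 84672je1)] -/
theorem localTamagawaNumber_three_g84672je1 {W : WeierstrassCurve ℚ} [W.IsElliptic] [W.IsGloballyMinimal]
    (hI : integralModelInt W = (⟨0, 0, 0, -203742, -35395542⟩ : WeierstrassCurve ℤ)) :
    (W.baseChange ℚ_[3]).localTamagawaNumber ℤ_[3] = 3 :=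
  localTamagawaNumber_padic_eq_of_intModel_of_tamX hI 3 (F := ⟨3, 1, 3, 0, 0, 0, 9, 1⟩) rfl (by decide +kernel)

/-- **The single-carrier clause of the ♯ₚ record for `84672je1` IN THE KERNEL**: `ord₃ ∏ c_ℓ ≤ ord₃ c₃` (`6 = 3·2`, `3 ∤ 2`).
[cite: Silverman1994, IV.9.4] [cite: CremonaAlgorithms1997, Table 1 (Cremona label 84672je1)] -/
theorem carrier_g84672je1 {W : WeierstrassCurve ℚ} [W.IsElliptic] [W.IsGloballyMinimal]
    (hI : integralModelInt W = (⟨0, 0, 0, -203742, -35395542⟩ : WeierstrassCurve ℤ)) :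
    padicValNat 3 W.tamagawaProduct ≤ padicValNat 3 ((W.baseChange ℚ_[3]).localTamagawaNumber ℤ_[3]) := by
  rw [tamagawaProduct_g84672je1 hI, localTamagawaNumber_three_g84672je1 hI]
  exact le_of_eq (padicValNat_eq_padicValNat_of_eq_mul (m := 2) Nat.prime_three rfl (by norm_num) (by norm_num))

/-- **RECORD `84672je1` @ `3` with the Tamagawa clause DISCHARGED** — `WildUpperUnitTwistRecords.missingUpperBoundAt_g84672je1_3` (file
`…SharpP08`, ♯ₚ road p610552) with `hcarrier` supplied by `carrier_g84672je1`; every other displayed binder unchanged (named facts,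
schema `hJp`, Cremona's `N = 84672`, `r_an = 0`, «tower not onto», lattice-optimal datum with `3 ∤ c(D)`, `K = ℚ(√-47)`, twist numerics).
Per pair; nothing booked; BSD is not proved by this. [cite: Jetchev2008, Cor. 1.5 (p. 812)] [cite: Silverman1994, IV.9.4]
[cite: Miller2011LMS, Def. 1.1] [cite: CremonaAlgorithms1997, Table 1 (Cremona label 84672je1)] -/
theorem missingUpperBoundAt_g84672je1_3_tam
    (hGZ : ∀ (N : ℕ) [NeZero N] (W : WeierstrassCurve ℚ) (K : Type) [Field K] [NumberField K],
      gross_zagier N W K)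
    (hKo : ∀ (N : ℕ) [NeZero N] (W : WeierstrassCurve ℚ) (K : Type) [Field K] [NumberField K],
      kolyvagin N W K)
    (hGZK : rank_eq_analyticRank_of_analyticRank_le_one) (hmod : hasEntireLFunction_rat)
    (hJp : ∀ (N : ℕ) [NeZero N] (W : WeierstrassCurve ℚ) [W.IsElliptic] [W.IsGloballyMinimal]
      (K : Type) [Field K] [NumberField K],
      IsImaginaryQuadratic K → NumberField.discr K ≠ -3 →
      SatisfiesHeegnerHypothesis N K → SatisfiesHeegnerHypothesis 2 K →
      ∀ (p : ℕ) [Fact p.Prime], p ≠ 2 → W.analyticRank = 0 → Addv W p → 0 ≤ padicValRat p W.j →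
      ¬ W.HasCM → W.HasIrreducibleModPGaloisRep p →
      ¬ (∀ n : ℕ, W.HasSurjectiveModNGaloisRep (p ^ n : ℕ)) →
      (∃ Dt : ModularParametrizationData W N,
        (∀ z ∈ Dt.L.lattice, ∃ w ∈ periodLattice Dt.f, z = (Dt.c : ℂ) * w) ∧ ¬ (p : ℤ) ∣ Dt.c) →
      ∀ {P : (W.baseChange K).toAffine.Point}, IsHeegnerPoint N W K P → ¬ IsOfFinAddOrder P → p ∣ N →
      padicValNat p (Nat.card (AddCommGroup.primaryComponent (W.baseChange K).sha p)) +
          2 * padicValNat p ((W.baseChange ℚ_[p]).localTamagawaNumber ℤ_[p]) ≤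
        2 * padicValNat p (AddSubgroup.zmultiples P).index)
    {W : WeierstrassCurve ℚ} [W.IsElliptic] [W.IsGloballyMinimal] (hWeq : W = (⟨0, 0, 0, (-203742), (-35395542)⟩ : WeierstrassCurve ℚ))
    (hN : W.conductorNorm ℤ = 84672) (hr : W.analyticRank = 0)
    (hns : ¬ (∀ n : ℕ, W.HasSurjectiveModNGaloisRep (3 ^ n : ℕ)))
    (D : ModularParametrizationData W 84672) (hopt : ∀ z ∈ D.L.lattice, ∃ w ∈ periodLattice D.f, z = (D.c : ℂ) * w)
    (hc : ¬ (3 : ℤ) ∣ D.c)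
    (K : Type) [Field K] [NumberField K] (hK : IsImaginaryQuadratic K) (hdK : NumberField.discr K = -47)
    {Wd : WeierstrassCurve ℚ} [Wd.IsElliptic] [Wd.IsGloballyMinimal] (hWdeq : Wd = (⟨0, 0, 0, (-450066078), 3674871357066⟩ : WeierstrassCurve ℚ))
    (hrd : Wd.analyticRank = 1) {qd : ℚ} (hqd : shaAn Wd = (qd : ℂ)) (hvd : padicValRat 3 qd ≤ 0) :
    MissingUpperBoundAt W 3 := by
  have hI : integralModelInt W = (⟨0, 0, 0, -203742, -35395542⟩ : WeierstrassCurve ℤ) := by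
    subst hWeq; exact integralModelInt_eq_of_map_eq _ (map_mk_int 0 0 0 (-203742) (-35395542))
  exact missingUpperBoundAt_g84672je1_3 hGZ hKo hGZK hmod hJp hWeq hN hr hns D hopt hc (carrier_g84672je1 hI) K hK hdK hWdeq hrd hqd hvd

end Summit.BirchSwinnertonDyer.BirchSwinnertonDyer.Theorems.WildUpperUnitTwistRecords

end
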